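import Summits.BirchSwinnertonDyer.BirchSwinnertonDyer.Theorems.UniversalToricDescentThinCombTorsionTransferCocycle
import Summits.BirchSwinnertonDyer.BirchSwinnertonDyer.Theorems.SignedBaseChangeAnticyclotomicEisensteinDivisibilityAwayDiscrepancy
import Summits.BirchSwinnertonDyer.BirchSwinnertonDyer.Theorems.UniversalToricDescentResidualSelmerTransport
import Literature.NumberTheory.EllipticCurves.GreenbergVatsal2000.NonPrimitiveDatumSelmerInvariants
import Literature.NumberTheory.EllipticCurves.ZpExtensionUnramifiedProofs
import Literature.NumberTheory.GaloisRepresentations.DecompositionGroupOfCompletion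
import HarnessLib

/-!
# Torsion transfer for line `thin_comb` (crux `AdditiveSplitIMCInclusionAtThree`, stmt-BirchSwinnertonDyer-20395), part V:
# SELMER BOOKKEEPING — the killing operator `Θ = Σᵢ cᵢ · conj_{δ^i}` maps the pull-back `res⁻¹(H¹_{nr,𝔭′}(K̃_∞, M))` into Greenberg–Vatsal's
# strict group over `K_∞^{κ}`, and an integer `t ≠ 0` then lands it in Castella's `Sel_𝔭′(K_∞^{κ}, E[p^∞])`
# (helper for `stub_torsionTransfer`, `--supports stmt-BirchSwinnertonDyer-20395`; cell `pub/bsd-wall`, lead `cruxlead-20395` g5)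

Setting: `κ₁, κ₂, κ : ZpExtension K p` with `pairKer κ₁ κ₂ ≤ ker κ` (a line through the presented `ℤ_p²`-tower), a discrete `Γ_K`-module
`M` with commuting scalars `R` (`scalarH1`), `𝔭′ ∋ p`, `δ ∈ D_𝔭′` and scalars `c₀, …` with the KILLING relation `Σ_{i∈s} cᵢ • δ^i • m = 0`
on `M`; `Θ a := Σ_{i∈s} cᵢ · conj_{δ^i} a` on `H¹(ker κ, M)`.

* §1 `inertiaIn_pairKer_eq_inertiaIn_kerSubgroup` (`v ∤ p`: every `ℤ_p`-extension is unramified at `v`,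
  `ZpExtension.inertia_le_kerSubgroup_holds`); conjugations COMMUTE on `H¹(ker κ, M)` (`Γ_K / ker κ` is abelian, inner automorphisms
  act trivially); the pull-back `res⁻¹(unrSelmer₂ κ₁ κ₂ M 𝔭′)` is stable under `conj_σ` and under the scalars.
* §2 `sum_scalarH1_conjH1_mem_datumStrictSelmer` — for `a ∈ H¹(ker κ, M)` with `res a ∈ H¹_{nr,𝔭′}(K̃_∞, M)`:
  **`Θ a ∈ datumStrictSelmer (ker κ) M p (bdpData M p 𝔭′) ∅`** (unramified away from `p`: transport of
  `CyclotomicZpExtensionUnramifiedAwayPProofs.resOfLe_mem_unramifiedOutside_iff` along §1; relaxed at the other primes above `p`;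
  STRICT at `𝔭′`: `TorsionTransferLocal.sum_conjH1_mem_strictKer` applied to every conjugate `conj_σ a`, with `conj_σ Θ = Θ conj_σ`).
* §3 `exists_nsmul_sum_mem_selmerAc` (`M = E[p^∞]`, all infinite places of `K` complex): ONE integer `t ≠ 0` with
  **`t • Θ a ∈ Sel_𝔭′(K_∞^{κ}, E[p^∞])`** (Castella, `Σ = ∅`) for all such `a` — §2 composed with the sibling crux's landed
  `SignedBaseChangeAcDivAwayDiscrepancy.exists_nsmul_mem_selmerAc_of_mem_datumStrictSelmer` (the away-from-`p` discrepancy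
  "unramified vs. trivial" has bounded exponent; nothing at `∞`; the strict conditions above `p` coincide).

Theorems only; no definition, no named fact, no `sorry`; nothing about BSD or the crux is asserted here.
References: [SkinnerUrban2014] §3.2.7, Prop. 3.2.8 (p. 23); [Castella2018] Def. 2.2, §2.2 (arXiv:1704.06608 pp. 5, 7); [GreenbergLNM1716]
§3 Lemma 3.3; [GreenbergVatsal2000] §2 pp. 15–17; [Washington1997] Prop. 13.2.
-/

set_option linter.dupNamespace false
set_option autoImplicit false

noncomputable section

open scoped Classical

open NumberField IsDedekindDomain Field
open Literature.NumberTheory.EllipticCurves Literature.NumberTheory.EllipticCurves.GreenbergSelmer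
  Literature.NumberTheory.EllipticCurves.GreenbergVatsal2000 Literature.NumberTheory.GaloisRepresentations
  Literature.NumberTheory.EllipticCurves.Castella2018 IsDedekindDomain.HeightOneSpectrum

namespace Summit.BirchSwinnertonDyer.BirchSwinnertonDyer.Theorems.UniversalToricDescentThinComb.TorsionTransferSelmerStrict

/-! ## §1 Inertia in the tower; commuting conjugations; stability of the pull-back -/

section General

variable {K : Type} [Field K] [NumberField K] {p : ℕ} [Fact p.Prime] (κ₁ κ₂ κ : ZpExtension K p)
  {M : Type} [AddCommGroup M] [DistribMulAction (absoluteGaloisGroup K) M] [TopologicalSpace M] [DiscreteTopology M]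
  {R : Type*} [Monoid R] [DistribMulAction R M] [SMulCommClass (absoluteGaloisGroup K) R M]

omit [Fact p.Prime] in
/-- `I_v ≤ ker κ'` for every `ℤ_p`-extension `κ'` and `v ∤ p` (the tree's `ZpExtension.inertia_le_kerSubgroup_holds`, read on the
chosen inertia group `GreenbergSelmer.inertia v = I_{𝔓₀}`). [cite: Washington1997, Prop. 13.2] -/
theorem greenbergInertia_le_kerSubgroup [Fact p.Prime] (κ' : ZpExtension K p) {v : HeightOneSpectrum (𝓞 K)}
    (hv : ((p : ℕ) : 𝓞 K) ∉ v.asIdeal) : inertia v ≤ κ'.kerSubgroup := by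
  have e : inertia v = (adicCompletionPrime K v).inertia (absoluteGaloisGroup K) :=
    (inertia_adicCompletionPrime_eq_map_absInertia K v).symm
  rw [e]
  exact ZpExtension.inertia_le_kerSubgroup_holds K p κ' hv (adicCompletionPrime_mem_primesAbove K v)

variable {κ₁ κ₂ κ}

/-- **Away from `p` the inertia groups of `K̃_∞` and `K_∞^{κ}` at the chosen place coincide**:
`inertiaIn (pairKer κ₁ κ₂) v = inertiaIn (ker κ) v` for `v ∤ p` (both are all of `I_v`). [cite: Washington1997, Prop. 13.2] -/
theorem inertiaIn_pairKer_eq_inertiaIn_kerSubgroup (hker : ZpExtension.pairKer κ₁ κ₂ ≤ κ.kerSubgroup)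
    {v : HeightOneSpectrum (𝓞 K)} (hv : ((p : ℕ) : 𝓞 K) ∉ v.asIdeal) :
    inertiaIn (ZpExtension.pairKer κ₁ κ₂) v = inertiaIn κ.kerSubgroup v := by
  ext x
  rw [mem_inertiaIn_iff, mem_inertiaIn_iff]
  constructor
  · rintro ⟨hx, hI⟩
    exact ⟨hker hx, hI⟩
  · rintro ⟨-, hI⟩
    exact ⟨Subgroup.mem_inf.mpr ⟨greenbergInertia_le_kerSubgroup κ₁ hv hI, greenbergInertia_le_kerSubgroup κ₂ hv hI⟩, hI⟩

omit [NumberField K] [TopologicalSpace M] [DiscreteTopology M] in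
/-- Every commutator of `Γ_K` lies in `ker κ` (`ℤ_p` is abelian). [cite: Washington1997, §13.1] -/
theorem mul_mul_inv_mul_inv_mem_kerSubgroup (σ τ : absoluteGaloisGroup K) : σ * τ * σ⁻¹ * τ⁻¹ ∈ κ.kerSubgroup := by
  rw [ZpExtension.mem_kerSubgroup, map_mul, map_mul, map_mul, map_inv, map_inv, mul_inv_cancel_comm, mul_inv_cancel]

omit [NumberField K] in
/-- **Conjugations commute on `H¹(ker κ, M)`**: `conj_σ conj_τ = conj_{στσ⁻¹τ⁻¹} conj_τ conj_σ` and the commutator acts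
trivially (`conjH1_of_mem`). [cite: SerreLocalFields1979, VII.§5 Prop. 3] -/
theorem conjH1_comm (σ τ : absoluteGaloisGroup K) (a : subgroupH1 κ.kerSubgroup M) :
    conjH1 κ.kerSubgroup M σ (conjH1 κ.kerSubgroup M τ a) = conjH1 κ.kerSubgroup M τ (conjH1 κ.kerSubgroup M σ a) := by
  have hmul := conjH1_mul_holds κ.kerSubgroup M
  rw [← AddMonoidHom.comp_apply, ← hmul, ← AddMonoidHom.comp_apply, ← hmul,
    show σ * τ = (σ * τ * σ⁻¹ * τ⁻¹) * (τ * σ) by group, hmul (σ * τ * σ⁻¹ * τ⁻¹), AddMonoidHom.comp_apply,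
    conjH1_of_mem_holds κ.kerSubgroup M (mul_mul_inv_mul_inv_mem_kerSubgroup σ τ), AddMonoidHom.id_apply]

omit [NumberField K] in
/-- The pull-back `res⁻¹(unrSelmer₂)` is stable under conjugation (`res` commutes with `conj_σ`; `unrSelmer₂` is `conj`-stable).
[cite: GreenbergVatsal2000, §2 p. 17] -/
theorem resOfLe_conjH1_mem_unrSelmer₂ [NumberField K] (hker : ZpExtension.pairKer κ₁ κ₂ ≤ κ.kerSubgroup)
    {vbar : HeightOneSpectrum (𝓞 K)} (σ : absoluteGaloisGroup K)
    {a : subgroupH1 κ.kerSubgroup M} (ha : resOfLe M hker a ∈ unrSelmer₂ κ₁ κ₂ M vbar) :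
    resOfLe M hker (conjH1 κ.kerSubgroup M σ a) ∈ unrSelmer₂ κ₁ κ₂ M vbar := by
  rw [← AddMonoidHom.comp_apply, resOfLe_comp_conjH1_holds (M := M) hker σ, AddMonoidHom.comp_apply]
  exact conjH1_mem_datumSelmer (ZpExtension.pairKer κ₁ κ₂) M p _ ∅ σ ha

/-- **The Greenberg group `unrSelmer₂ κ₁ κ₂ M v̄` is stable under the scalars** (`scalarH1 r`): conjugation commutes with scalars,
scalars preserve the unramified kernels (`UniversalToricDescentResidualSelmer.resH1Hom_id_mem_unramifiedKer`) and Greenberg's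
kernels (`LocalDatum.scalarH1_mem_greenbergKer`; the data `bdpData` have `M⁺ ∈ {0, M}`). [cite: EmertonPollackWeston2006, §3.1] -/
theorem scalarH1_mem_unrSelmer₂ {vbar : HeightOneSpectrum (𝓞 K)} (r : R)
    {s : subgroupH1 (ZpExtension.pairKer κ₁ κ₂) M} (hs : s ∈ unrSelmer₂ κ₁ κ₂ M vbar) :
    scalarH1 (ZpExtension.pairKer κ₁ κ₂) M r s ∈ unrSelmer₂ κ₁ κ₂ M vbar := by
  have e : ∀ σ : absoluteGaloisGroup K, conjH1 (ZpExtension.pairKer κ₁ κ₂) M σ (scalarH1 (ZpExtension.pairKer κ₁ κ₂) M r s) =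
      scalarH1 (ZpExtension.pairKer κ₁ κ₂) M r (conjH1 (ZpExtension.pairKer κ₁ κ₂) M σ s) := fun σ ↦ by
    rw [← AddMonoidHom.comp_apply, conjH1_comp_scalarH1, AddMonoidHom.comp_apply]
  rw [unrSelmer₂_eq, mem_datumSelmer_iff, mem_unramifiedOutside_iff] at hs ⊢
  refine ⟨fun v hv hpv σ ↦ ?_, fun v hv σ ↦ ?_⟩
  · rw [e]
    exact UniversalToricDescentResidualSelmer.resH1Hom_id_mem_unramifiedKer (ZpExtension.pairKer κ₁ κ₂) v
      (DistribSMul.toAddMonoidHom M r) (fun g m ↦ (smul_comm g r m).symm) _ (hs.1 v hv hpv σ)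
  · rw [e]
    exact (AcSelmer.bdpData M p vbar v hv).scalarH1_mem_greenbergKer (ZpExtension.pairKer κ₁ κ₂) r
      (fun m hm ↦ by
        by_cases hvv : v = vbar
        · subst hvv
          rw [AcSelmer.bdpData_self p v hv] at hm ⊢
          have hm0 : m = 0 := AddSubgroup.mem_bot.mp hm
          rw [hm0, smul_zero]
          exact AddSubgroup.zero_mem _
        · rw [AcSelmer.bdpData_of_ne p vbar hv hvv] at hm ⊢
          exact AddSubgroup.mem_top _)
      (hs.2 v hv σ)

omit [NumberField K] in
/-- The pull-back `res⁻¹(unrSelmer₂)` is stable under the scalars (`res` commutes with `scalarH1`).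
[cite: EmertonPollackWeston2006, §3.1] -/
theorem resOfLe_scalarH1_mem_unrSelmer₂ [NumberField K] (hker : ZpExtension.pairKer κ₁ κ₂ ≤ κ.kerSubgroup)
    {vbar : HeightOneSpectrum (𝓞 K)} (r : R)
    {a : subgroupH1 κ.kerSubgroup M} (ha : resOfLe M hker a ∈ unrSelmer₂ κ₁ κ₂ M vbar) :
    resOfLe M hker (scalarH1 κ.kerSubgroup M r a) ∈ unrSelmer₂ κ₁ κ₂ M vbar := by
  rw [← AddMonoidHom.comp_apply, resOfLe_comp_scalarH1, AddMonoidHom.comp_apply]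
  exact scalarH1_mem_unrSelmer₂ r ha

/-! ## §2 `Θ` maps the pull-back into the strict Greenberg–Vatsal group over `K_∞^{κ}` -/

/-- **`Θ a = Σᵢ cᵢ · conj_{δ^i} a` lies in `datumStrictSelmer (ker κ) M p (bdpData M p 𝔭′) ∅`** whenever `res a ∈ H¹_{nr,𝔭′}(K̃_∞, M)`,
for `δ ∈ D_𝔭′` and scalars with `Σᵢ cᵢ • δ^i • m = 0` on `M`: unramified away from `p` (the tower is unramified there, §1), relaxed at
`v ∣ p`, `v ≠ 𝔭′`, and STRICT at `𝔭′` by the local killing `TorsionTransferLocal.sum_conjH1_mem_strictKer` applied to every conjugate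
`conj_σ a` (conjugations commute with `Θ`). [cite: SkinnerUrban2014, Prop. 3.2.8 (p. 23)] [cite: GreenbergVatsal2000, §2 pp. 15–17] -/
theorem sum_scalarH1_conjH1_mem_datumStrictSelmer (hker : ZpExtension.pairKer κ₁ κ₂ ≤ κ.kerSubgroup)
    {vbar : HeightOneSpectrum (𝓞 K)} (hvbar : ((p : ℕ) : 𝓞 K) ∈ vbar.asIdeal)
    {δ : absoluteGaloisGroup K} (hδ : δ ∈ decomp vbar) (s : Finset ℕ) (c : ℕ → R)
    (hkill : ∀ m : M, ∑ i ∈ s, c i • (δ ^ i • m) = 0)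
    {a : subgroupH1 κ.kerSubgroup M} (ha : resOfLe M hker a ∈ unrSelmer₂ κ₁ κ₂ M vbar) :
    (∑ i ∈ s, scalarH1 κ.kerSubgroup M (c i) (conjH1 κ.kerSubgroup M (δ ^ i) a)) ∈
      datumStrictSelmer κ.kerSubgroup M p (AcSelmer.bdpData M p vbar) ∅ := by
  -- the sum stays in the pull-back
  have hΘres : ∀ {b : subgroupH1 κ.kerSubgroup M}, resOfLe M hker b ∈ unrSelmer₂ κ₁ κ₂ M vbar →
      resOfLe M hker (∑ i ∈ s, scalarH1 κ.kerSubgroup M (c i) (conjH1 κ.kerSubgroup M (δ ^ i) b)) ∈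
        unrSelmer₂ κ₁ κ₂ M vbar := by
    intro b hb
    rw [map_sum]
    exact AddSubgroup.sum_mem _ fun i _ ↦
      resOfLe_scalarH1_mem_unrSelmer₂ hker (c i) (resOfLe_conjH1_mem_unrSelmer₂ hker (δ ^ i) hb)
  -- `Θ` commutes with conjugation
  have hΘconj : ∀ (σ : absoluteGaloisGroup K) (b : subgroupH1 κ.kerSubgroup M),
      conjH1 κ.kerSubgroup M σ (∑ i ∈ s, scalarH1 κ.kerSubgroup M (c i) (conjH1 κ.kerSubgroup M (δ ^ i) b)) =
        ∑ i ∈ s, scalarH1 κ.kerSubgroup M (c i) (conjH1 κ.kerSubgroup M (δ ^ i) (conjH1 κ.kerSubgroup M σ b)) := by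
    intro σ b
    rw [map_sum]
    refine Finset.sum_congr rfl fun i _ ↦ ?_
    rw [← AddMonoidHom.comp_apply, conjH1_comp_scalarH1, AddMonoidHom.comp_apply, conjH1_comm]
  rw [mem_datumStrictSelmer_iff]
  refine ⟨?_, fun v hv σ ↦ ?_⟩
  · -- unramified away from `p`: transport from `K̃_∞`
    exact (resOfLe_mem_unramifiedOutside_iff hker p ∅
      (fun v _ hpv ↦ inertiaIn_pairKer_eq_inertiaIn_kerSubgroup hker hpv) _).mp
      (unrSelmer₂_le_unramifiedOutside κ₁ κ₂ M vbar (hΘres ha))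
  · by_cases hvv : v = vbar
    · subst hvv
      rw [AcSelmer.bdpData_self p v hv, hΘconj]
      -- the local killing at `𝔭′` for the conjugate `conj_σ a`
      have ha' := resOfLe_conjH1_mem_unrSelmer₂ hker (vbar := v) σ ha
      have hgr : resOfLe M hker (conjH1 κ.kerSubgroup M σ a) ∈
          (AcSelmer.strictDatum M v).greenbergKer (ZpExtension.pairKer κ₁ κ₂) := by
        have h := ((mem_datumSelmer_iff _).mp ha').2 v hv 1
        rwa [AcSelmer.bdpData_self p v hv, conjH1_one_holds (ZpExtension.pairKer κ₁ κ₂) M, AddMonoidHom.id_apply] at h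
      exact TorsionTransferLocal.sum_conjH1_mem_strictKer hker
        (fun g hg i _ ↦ TorsionTransferLocal.pow_inv_mul_conj_mem
          (TorsionTransferLocal.inv_mul_mul_mul_inv_mem_pairKer κ₁ κ₂) v hδ g hg i)
        (fun i ↦ DistribSMul.toAddMonoidHom M (c i)) (fun i g m ↦ (smul_comm g (c i) m).symm) hkill hgr
    · rw [AcSelmer.bdpData_of_ne p vbar hv hvv, AcSelmer.strictKer_relaxedDatum_eq_top]
      exact AddSubgroup.mem_top _

end General

/-! ## §3 `M = E[p^∞]`: an integer lands `Θ a` in Castella's `Sel_𝔭′(K_∞^{κ}, E[p^∞])` -/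

section Curve

variable {K : Type} [Field K] [NumberField K] (W : WeierstrassCurve K) [W.IsElliptic] {p : ℕ} [Fact p.Prime]
  {κ₁ κ₂ : ZpExtension K p} (κ : ZpExtension K p)
  {R : Type*} [Monoid R] [DistribMulAction R (W.geomPrimaryTorsion p)]
  [SMulCommClass (absoluteGaloisGroup K) R (W.geomPrimaryTorsion p)]

variable {κ}

/-- **The Selmer end of the torsion transfer**: for `K` with all infinite places complex, a line `κ` through the pair, `𝔭′ ∋ p`,
`δ ∈ D_𝔭′` and scalars with `Σᵢ cᵢ • δ^i • m = 0` on `E[p^∞]`, there is ONE integer `t ≠ 0` such that for every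
`a ∈ H¹(K_∞^{κ}, E[p^∞])` whose restriction lies in `H¹_{nr,𝔭′}(K̃_∞, E[p^∞])`:
**`t • Σᵢ cᵢ · conj_{δ^i} a ∈ Sel_𝔭′(K_∞^{κ}, E[p^∞])`**. [cite: SkinnerUrban2014, Prop. 3.2.8 (p. 23)] [cite: Castella2018, §2.2 (arXiv:1704.06608 p. 7)] -/
theorem exists_nsmul_sum_mem_selmerAc (hK : ∀ w : InfinitePlace K, w.IsComplex)
    (hker : ZpExtension.pairKer κ₁ κ₂ ≤ κ.kerSubgroup)
    {vbar : HeightOneSpectrum (𝓞 K)} (hvbar : ((p : ℕ) : 𝓞 K) ∈ vbar.asIdeal)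
    {δ : absoluteGaloisGroup K} (hδ : δ ∈ decomp vbar) (s : Finset ℕ) (c : ℕ → R)
    (hkill : ∀ m : W.geomPrimaryTorsion p, ∑ i ∈ s, c i • (δ ^ i • m) = 0) :
    ∃ t : ℕ, t ≠ 0 ∧ ∀ a : W.subgroupH1 p κ.kerSubgroup,
      W.resOfLe p hker a ∈ unrSelmer₂ κ₁ κ₂ (W.geomPrimaryTorsion p) vbar →
        t • (∑ i ∈ s, scalarH1 κ.kerSubgroup (W.geomPrimaryTorsion p) (c i) (W.conjH1 p κ.kerSubgroup (δ ^ i) a)) ∈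
          AcSelmer.selmerAc W p κ vbar ∅ := by
  obtain ⟨t, ht, h⟩ :=
    SignedBaseChangeAcDivAwayDiscrepancy.exists_nsmul_mem_selmerAc_of_mem_datumStrictSelmer W p κ hK hvbar
  exact ⟨t, ht, fun a ha ↦ h _ (sum_scalarH1_conjH1_mem_datumStrictSelmer hker hvbar hδ s c hkill ha)⟩

end Curve

end Summit.BirchSwinnertonDyer.BirchSwinnertonDyer.Theorems.UniversalToricDescentThinComb.TorsionTransferSelmerStrict

end
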